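/-
Origin: expansion seat `planner-pub-hodgecm-pv06-g3-0`, handover #3 2026-08-18T06:15:56Z (`HOME/pub-hodgecm-pv06-g3/lean/Pv06g3/CompactApproxReg.lean`, md5 65e8ff6d, 110 lines);
landed by the gen-6 packager in gate run 24 as `HodgeCM/Automorphic/CompactApproxReg.lean` (import ^import Pv06g3\.CompactApproxBridge\b→import HodgeCM.Automorphic.CompactApproxBridge ×1; import ^import Pv15g2\.→import HodgeCM.Automorphic. ×1).
-/
/-
Origin: HOME/pub-hodgecm-pv06-g3/lean/Pv06g3/CompactApproxReg.lean — session planner-pub-hodgecm-pv06-g3-0 (unit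
pub-hodgecm-pv06-g3, DAG-NODE PROVER #06 of 15, generation 3).  Intended final place: `HodgeCM/Automorphic/CompactApproxReg.lean`
(namespace `HodgeCM.PerL34.CompactApprox`).  WIP imports: `Pv06g3.CompactApproxBridge` ↦ `HodgeCM.Automorphic.CompactApproxBridge`
(my HANDOVER #2, run 24) and `Pv15g2.ThetaCarrierReg` ↦ `HodgeCM.Automorphic.ThetaCarrierReg` (seat pv15-g2, HANDOVER #1, run 24;
lands AFTER both).  Closed: nothing cited, nothing posited.

# The compact approximation for pv15-g2's regular-model carriers

Seat pv15-g2 fixed `H := L²(G ⧸ Γ, μQ)` and DEFINED `R := RegularRep.koopman μQ` (`R(g) v = v ∘ (g⁻¹ • ·)`), leaving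
the core with TWO analytic fields, `RegCoreCarrier.Analytic = {discreteDecomp, hatτ_complete}`.  Their `RegularRep.koopman μQ`
IS `QuotientSmoothing.ρHom μQ` (`regularRep_koopman_eq_ρHom`, definitional up to the `MeasurePreserving` proof term), so
`CompactApproxBridge` applies verbatim:

* `hasCompactApprox_regularRep`, `discreteDecomp_regularRep` — compact approximation and DISCRETE DECOMPOSITION of
  `L²(G ⧸ Γ, μQ)` under `RegularRep.koopman μQ`, `G ⧸ Γ` compact, PROVED;
* `regAnalytic_of_hatτ_complete` — **pv15-g2's `RegCoreCarrier.Analytic` follows from `hatτ_complete` ALONE** in the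
  cocompact model: of gen 3's three core axioms (`R_unitary`, `discreteDecomp`, `hatτ_complete`) only the `G_U`-side
  completeness datum remains, and it constrains nothing else in the carrier (it is satisfiable by `hatτ := fun _ => ⊤`).
-/
import Summits.HodgeConjecture.HodgeCM.Automorphic.CompactApproxBridge
import Summits.HodgeConjecture.HodgeCM.Automorphic.ThetaCarrierReg_2

/-! PORT of `HodgeCM/Automorphic/CompactApproxReg.lean` (HodgeCMPerL run 82) — verbatim mechanical port; provenance in the PORT header line. -/

set_option autoImplicit false

noncomputable section

open MeasureTheory Filter Topology Set
open scoped InnerProductSpace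

attribute [-instance] Quotient.instMeasurableSpace

namespace HodgeCM
namespace PerL34
namespace CompactApprox

open QuotientSmoothing

section Model

variable {G : Type*} [Group G] [TopologicalSpace G] [IsTopologicalGroup G] {Γ : Subgroup G}
variable [MeasurableSpace (G ⧸ Γ)] [BorelSpace (G ⧸ Γ)] (ν : Measure (G ⧸ Γ)) [SMulInvariantMeasure G (G ⧸ Γ) ν]

/-- **pv15-g2's regular representation IS `QuotientSmoothing.ρHom`** (same operator `v ↦ v ∘ (g⁻¹ • ·)`). -/
theorem regularRep_koopman_eq_ρHom : RegularRep.koopman ν = ρHom ν (G := G) := by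
  refine MonoidHom.ext fun g => ContinuousLinearMap.ext fun v => ?_
  change RegularRep.koopman ν g v = ρ ν g v
  rw [Lp.ext_iff]
  filter_upwards [RegularRep.coeFn_koopman ν g v, coeFn_ρ ν g v] with x h1 h2
  rw [h1, h2]

variable [T2Space (G ⧸ Γ)] [IsFiniteMeasure ν] [ν.InnerRegularCompactLTTop] [CompactSpace (G ⧸ Γ)]
variable [MeasurableSpace G] [BorelSpace G] (μ : Measure G) [IsFiniteMeasureOnCompacts μ] [μ.IsOpenPosMeasure]
variable [LocallyCompactSpace G] [DiscreteTopology Γ] [Countable Γ] (hΓ : IsClosed (Γ : Set G))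
  [μ.IsMulLeftInvariant] [μ.IsMulRightInvariant] [μ.IsInvInvariant]
  {𝓕 : Set G} (h𝓕 : IsFundamentalDomain Γ.op 𝓕 μ)
  (hν : ν = Measure.map (QuotientGroup.mk : G → G ⧸ Γ) (μ.restrict 𝓕))

include μ hΓ h𝓕 hν in
/-- Compact approximation of `L²(G ⧸ Γ)` under `RegularRep.koopman`, `G ⧸ Γ` compact — PROVED. -/
theorem hasCompactApprox_regularRep : RepDecomp.HasCompactApprox (RegularRep.koopman ν (G := G)) := by
  rw [regularRep_koopman_eq_ρHom]
  exact hasCompactApprox_ρHom ν μ hΓ h𝓕 hν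

include μ hΓ h𝓕 hν in
/-- **Discrete decomposition of `L²(G ⧸ Γ)` under `RegularRep.koopman`, `G ⧸ Γ` compact — PROVED**: the statement of
pv15-g2's field `RegCoreCarrier.Analytic.discreteDecomp`. -/
theorem discreteDecomp_regularRep :
    (⨆ V : RepDecomp.Irr (RegularRep.koopman ν (G := G)), (V.1 : Submodule ℂ (Lp ℂ 2 ν))).topologicalClosure = ⊤ := by
  rw [regularRep_koopman_eq_ρHom]
  exact discreteDecomp_ρHom ν μ hΓ h𝓕 hν

end Model

section Carrier

variable {G : Type} [Group G] [TopologicalSpace G] [IsTopologicalGroup G] [MeasurableSpace G] [BorelSpace G]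
variable {Γ : Subgroup G} [MeasurableSpace (G ⧸ Γ)] [BorelSpace (G ⧸ Γ)]
variable {μQ : Measure (G ⧸ Γ)} [SMulInvariantMeasure G (G ⧸ Γ) μQ]
variable [T2Space (G ⧸ Γ)] [IsFiniteMeasure μQ] [μQ.InnerRegularCompactLTTop] [CompactSpace (G ⧸ Γ)]
variable (μ : Measure G) [IsFiniteMeasureOnCompacts μ] [μ.IsOpenPosMeasure]
variable [LocallyCompactSpace G] [DiscreteTopology Γ] [Countable Γ] (hΓ : IsClosed (Γ : Set G))
  [μ.IsMulLeftInvariant] [μ.IsMulRightInvariant] [μ.IsInvInvariant]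
  {𝓕 : Set G} (h𝓕 : IsFundamentalDomain Γ.op 𝓕 μ)
  (hν : μQ = Measure.map (QuotientGroup.mk : G → G ⧸ Γ) (μ.restrict 𝓕))
variable {HG CG SK SigIdxG : Type}
variable [NormedAddCommGroup HG] [InnerProductSpace ℂ HG] [CompleteSpace HG]
variable [NormedAddCommGroup CG] [NormedSpace ℂ CG] [TopologicalSpace SK]

include μ hΓ h𝓕 hν in
/-- **pv15-g2's `RegCoreCarrier.Analytic` from `hatτ_complete` alone** (cocompact model): `discreteDecomp` is the
theorem `discreteDecomp_regularRep`. -/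
theorem regAnalytic_of_hatτ_complete (C : RegCoreCarrier G Γ μQ HG CG SK SigIdxG)
    (hτ : (⨆ j, C.hatτ j).topologicalClosure = ⊤) : C.Analytic where
  discreteDecomp := discreteDecomp_regularRep μQ μ hΓ h𝓕 hν
  hatτ_complete := hτ

include μ hΓ h𝓕 hν in
/-- … hence gen 3's full `RepCoreCarrier.Analytic` for the regular-model core, from `hatτ_complete` alone. -/
theorem repAnalytic_of_hatτ_complete (C : RegCoreCarrier G Γ μQ HG CG SK SigIdxG)
    (hτ : (⨆ j, C.hatτ j).topologicalClosure = ⊤) : C.toRepCoreCarrier.Analytic :=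
  RegCoreCarrier.toRepCoreCarrier_analytic (regAnalytic_of_hatτ_complete μ hΓ h𝓕 hν C hτ)

end Carrier

end CompactApprox
end PerL34
end HodgeCM

end
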